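import Summits.QuantumFields.BalabanUV.Beta.GAN24.T2ShapeHalfMemberOfLetterRows
import Summits.QuantumFields.BalabanUV.Beta.GAN24.BlockCommutatorStepLetter
import Summits.QuantumFields.BalabanUV.Beta.SpineRecursivePureParity

/-!
# `BalabanUV.Beta.GAN24.T2ShapeEvenMemberOfWardLetters` — binder row G-an2-4 ∕ (CONV-C), W-slot, the (α-0) parity re-cut: **«T2Shape^{ev}» AT D1's PIN FROM THE WARD
# LETTERS, THE LEG ROWS AND (C) ONLY** — FILE 3c of the journal INTENT [LEAF03-G66-ONLINE] «DIVERGENCE LETTERS ⇒ CELL»: FILE 3b at `ε = 1` and the pin `cE = Lc⁴` with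
# THREE more displayed rows DISCHARGED BY NAME — the S-slot rows `(hS, hSall)` by the OWNER gan24-p1 g22's `SrecAtSlotRowsFinal.exists_hS_hSall_SrecAt_three`, the two S-slot
# rows `hE₁ hE₂` of the slaved summand by gan24-p2 g45's `BlockCommutatorStepLetter.exists_evenRows_uniform_three` (over MY `SlavedSummandLetterRows`), the commutator parity
# `hCm` by d1-leaf-05's `SpineRecursivePureParity.trK_SpureRecAt` ⨾ leaf-01 g72's `parityEven_comm_of_oddRows`.

NOT IN PRINT; OUR BOOKKEEPING (G-an2-4 crux team (2), leaf prover `b2b-balaban-gan24-formalise-leaf-03`, gen 66).  [folklore] composition BY NAME; 0 `def`, 0 cited facts,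
0 `def … : Prop`, 0 sorry.  HONEST FRAMING (cell contract, verbatim): «discharging `BetaPertH` makes Bałaban's UV stability UNCONDITIONAL — a real constructive-QFT result;
it is NOT the continuum limit and NOT the Clay problem.»  HONEST DEPENDENCY (verbatim): «continuum YM on T⁴ ⇐ BetaPertH ∧ nine spine estimates (0/9 proved); BetaPertH ⇐
(D1) ∧ (D4) ∧ CAP+tail; G-an2-4 gates asym, D1 and NE2/3/4.»

## What (`d = 3`, `2 ≤ Lc`, in-block root `r`, PIN `cE = Lc⁴`, `|cE₂| ≤ Lc^8`, any `cVH cΛ cB Tc`, off-diagonal `Lc`-covariant `LocStencil₂` border `vh₂S`)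
**`t2ShapeEven_three_of_wardLetters`** — `∃ C₂ δ₂, 0 < δ₂ ∧ ∀ n, LocStencil₂ (½ • (T♮̃_n + 1 • P T♮̃_n)) C₂ δ₂` (the EVEN member, `ε = 1` literal; `…_junction` = the same in the
junction spelling `½ • (T♮̃_n + P T♮̃_n)` by `one_smul`) from EXACTLY THESE DISPLAYED ROWS: the border rows (`hBff hBmm hB hBt`); per level `l` D1's RAW TABLE LAWS `hTL ∕ hTL″` for the comb member `T2RecAt … l` with
the first-order partner PINNED to `SpureRecAt 3 Lc ρ cE cVH cΛ l`, the block generators PINNED to `diagK (½ • Σ_{v∈box} legInd ρ (Lc•Y + v))`, FREE residual words `R_l R″_l`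
(parity-ODD: `hR hR″`) and lock constants `cH_l ≠ 0` (at the literal: D1's `WardLocusQuarticTable.tableLaw_T2RecAt_succ ∕ _zero` under ITS Ward data — leaf-01's PART 3 pin);
ONE scalar row `hcH : ∀ l, |(sf_l·sm_l)⁻¹·(cH_l)⁻¹| ≤ c₀` (p2's located hypothesis; `l`-free at the comb's units); THE TWO LEG ROWS `hL₁ hL₂` on the even member (`∀ l`, one constant
each) = (Q-L) in letter currency (row L11, (H1)^{⊥} display, OPEN); `hC` = (C) at the relative source (⟸ (C) of record by leaf-01's `RelSourceHalfCharge.zsym_relSource_half`).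
THIS IS WHERE THE W-SLOT's EVEN SIDE STANDS: modulo D1's own Ward data and one scalar units row, «T2Shape^{ev}» ⟸ (Q-L) ∧ (C).  Asserts NO shape of Bałaban's tables beyond these
rows and NO value of any charge; discharges NOTHING of (Q-L) ∕ (C) ∕ «T2Drift» ∕ (hW, hWall); (β) of record untouched; NOT «W-slot closed»; NEVER «G-an2-4 closed» as (CONV-C);
NOT D1, NOT `BetaPertH`, NOT continuum, NOT Clay; not in print.  Unit `b2b-balaban-gan24-formalise-leaf-03` (gen 66), 2026-08-23.
-/

noncomputable section

open Finset
open scoped BigOperators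
open Literature.MathematicalPhysics.QuantumFieldTheory
open Literature.MathematicalPhysics.QuantumFieldTheory.Balaban1983to89
open Literature.MathematicalPhysics.QuantumFieldTheory.Balaban1983to89.Beta
open ExpKernelCalculus (MKer shiftK BiLoc Decays comp)
open OneStepResolventKernel (Fib LocStencil)
open OneStepKernelFamily (KInvStep)
open AffineAveraging (box toSite unitVec)
open AveragingMixedJetTables (mixFFAt)
open SecondOrderResponse (W2SymOfK)
open KernelWard (divV)
open BalabanCompositeJets (LocStencil₂)
open BalabanStepJetsSucc (mmRead)
open BalabanStepW2 (K3OfK M2Of)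
open Summit.QuantumFields.BalabanUV.Beta.TameKernelCalculus (trK)
open Summit.QuantumFields.BalabanUV.Beta.BorderedHessian (sgnK diagK)
open Summit.QuantumFields.BalabanUV.Beta.AveragingWardRootedStencils (legInd)
open Summit.QuantumFields.BalabanUV.Beta.HessKerDressedUnits (unitK unitS)
open Summit.QuantumFields.BalabanUV.Beta.SecondOrderUnits (unitM unitS₂ unitM₂)
open Summit.QuantumFields.BalabanUV.Beta.AxialDressingRooted (coDressKBmAt)
open Summit.QuantumFields.BalabanUV.Beta.SpineRooted (T2RecAt SpureRecAt M1At e3OfK)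
open Summit.QuantumFields.BalabanUV.Beta.SpineRecursivePureParity (trK_SpureRecAt)
open Summit.QuantumFields.BalabanUV.Beta.GAN24.CombesThomas (sfStep smStep)
open Summit.QuantumFields.BalabanUV.Beta.GAN24.T2RecursionAffine (lin4)
open Summit.QuantumFields.BalabanUV.Beta.GAN24.BiStencilZeroMode (zmode)
open Summit.QuantumFields.BalabanUV.Beta.GAN24.SrecAtSlotRowsFinal (exists_hS_hSall_SrecAt_three)
open Summit.QuantumFields.BalabanUV.Beta.GAN24.HalfMemberSlavedDivergence (parityEven_comm_of_oddRows)
open Summit.QuantumFields.BalabanUV.Beta.GAN24.BlockCommutatorStepLetter (exists_evenRows_uniform_three)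
open Summit.QuantumFields.BalabanUV.Beta.GAN24.T2ShapeHalfMemberOfLetterRows (locStencil₂_halfMember_three_of_letterRows)

namespace Summit.QuantumFields.BalabanUV.Beta.GAN24.T2ShapeEvenMemberOfWardLetters

variable {Lc : ℕ} [NeZero Lc] {r : Fin (3 + 1) → ℕ}

/-- NOT IN PRINT; OUR BOOKKEEPING.  **«T2Shape^{ev}» FROM D1's WARD LETTERS, ONE SCALAR ROW, THE LEG ROWS AND (C)** (`d = 3`, `2 ≤ Lc`, in-block root, PIN `cE = Lc⁴`,
`|cE₂| ≤ Lc^8`): FILE 3b `locStencil₂_halfMember_three_of_letterRows` at `ε = 1`, `S_l := SpureRecAt … l`, `X := diagK (½ • Σ_v legInd ρ (Lc•· + v))`, with `(hS, hSall)`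
(the OWNER g22), `hE₁ hE₂` (p2 g45 over MY `SlavedSummandLetterRows`) and `hCm` (d1-leaf-05 ⨾ leaf-01) DISCHARGED BY NAME.  Displayed: border rows, D1's raw table laws
`hTL hTL″` with free odd residual words `R_l R″_l` and lock constants `cH_l`, the scalar row `hcH`, THE LEG ROWS (= (Q-L)), `hC` (= (C)).  Nothing of (Q-L) ∕ (C) is
discharged. -/
theorem t2ShapeEven_three_of_wardLetters (hLc : 2 ≤ Lc) (hr : r ∈ box (3 + 1) Lc) (cE cVH cΛ cE₂ cB : ℝ) (hcE : cE = (Lc : ℝ) ^ (3 + 1))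
    (hpin : |cE₂| ≤ (Lc : ℝ) ^ (2 * (3 + 1))) (Tc : Fin 4 → Fin 4 → Fin 4 → Fin 4 → ℝ)
    {vh₂S : Fin (3 + 1) → (Fin (3 + 1) → ℤ) → Fin (3 + 1) → (Fin (3 + 1) → ℤ) → MKer (3 + 1) (Fib 3)}
    (hBff : ∀ κ u κ' u' x z (α β : Fin (3 + 1)), vh₂S κ u κ' u' x z (Sum.inl α) (Sum.inl β) = 0)
    (hBmm : ∀ κ u κ' u' x z (μ ν : Fin (3 + 1)), vh₂S κ u κ' u' x z (Sum.inr μ) (Sum.inr ν) = 0)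
    {CB δB : ℝ} (hB : LocStencil₂ vh₂S CB δB) (hδB : 0 < δB)
    (hBt : ∀ (κ : Fin (3 + 1)) (u : Fin (3 + 1) → ℤ) (κ' : Fin (3 + 1)) (u' t : Fin (3 + 1) → ℤ),
        vh₂S κ (u + (Lc : ℤ) • t) κ' (u' + (Lc : ℤ) • t) = shiftK (-((Lc : ℤ) • t)) (vh₂S κ u κ' u'))
     {R R'' : ℕ → (Fin (3 + 1) → ℤ) → Fin (3 + 1) → (Fin (3 + 1) → ℤ) → MKer (3 + 1) (Fib 3)} {cH : ℕ → ℝ} (hcH0 : ∀ l, cH l ≠ 0) {c₀ : ℝ}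
    (hcH : ∀ l, |(sfStep Lc l * smStep 3 Lc l)⁻¹ * (cH l)⁻¹| ≤ c₀)
    (hTL : ∀ (l : ℕ) (Y : Fin (3 + 1) → ℤ) (κ' : Fin (3 + 1)) (u' : Fin (3 + 1) → ℤ),
      cH l • ∑ v ∈ box (3 + 1) Lc, divV (fun κ u => T2RecAt 3 Lc (toSite r) cE cVH cΛ cE₂ cB Tc vh₂S (mixFFAt (toSite r) Lc) l κ u κ' u') ((Lc : ℤ) • Y + toSite v)
        = comp (SpureRecAt 3 Lc (toSite r) cE cVH cΛ l κ' u') (diagK (((1 : ℝ) / 2) • ∑ v ∈ box (3 + 1) Lc, legInd (toSite r) ((Lc : ℤ) • Y + toSite v))) - comp (diagK (((1 : ℝ) / 2) • ∑ v ∈ box (3 + 1) Lc, legInd (toSite r) ((Lc : ℤ) • Y + toSite v))) (SpureRecAt 3 Lc (toSite r) cE cVH cΛ l κ' u') + R l Y κ' u')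
    (hTL'' : ∀ (l : ℕ) (Y : Fin (3 + 1) → ℤ) (κ : Fin (3 + 1)) (u : Fin (3 + 1) → ℤ),
      cH l • ∑ v ∈ box (3 + 1) Lc, divV (T2RecAt 3 Lc (toSite r) cE cVH cΛ cE₂ cB Tc vh₂S (mixFFAt (toSite r) Lc) l κ u) ((Lc : ℤ) • Y + toSite v)
        = comp (SpureRecAt 3 Lc (toSite r) cE cVH cΛ l κ u) (diagK (((1 : ℝ) / 2) • ∑ v ∈ box (3 + 1) Lc, legInd (toSite r) ((Lc : ℤ) • Y + toSite v))) - comp (diagK (((1 : ℝ) / 2) • ∑ v ∈ box (3 + 1) Lc, legInd (toSite r) ((Lc : ℤ) • Y + toSite v))) (SpureRecAt 3 Lc (toSite r) cE cVH cΛ l κ u) + R'' l Y κ u)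
    (hR : ∀ (l : ℕ) (Y : Fin (3 + 1) → ℤ) (κ : Fin (3 + 1)) (u : Fin (3 + 1) → ℤ), trK (R l Y κ u) = -sgnK (R l Y κ u))
    (hR'' : ∀ (l : ℕ) (Y : Fin (3 + 1) → ℤ) (κ : Fin (3 + 1)) (u : Fin (3 + 1) → ℤ), trK (R'' l Y κ u) = -sgnK (R'' l Y κ u))
    {CL₁ CL₂ δ : ℝ} (hδ : 0 < δ)
    (hL₁ : ∀ l, LocStencil₂ (fun κ u κ' u' => fun (p z : Fin (3 + 1) → ℤ) (_ : Fib 3) (b : Fib 3) =>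
      ∑ β : Fin (3 + 1), ((((1 : ℝ) / 2) • (unitS₂ (sfStep Lc l) (smStep 3 Lc l) (T2RecAt 3 Lc (toSite r) cE cVH cΛ cE₂ cB Tc vh₂S (mixFFAt (toSite r) Lc) l)
        + (1 : ℝ) • fun κ u κ' u' => sgnK (trK ((unitS₂ (sfStep Lc l) (smStep 3 Lc l) (T2RecAt 3 Lc (toSite r) cE cVH cΛ cE₂ cB Tc vh₂S (mixFFAt (toSite r) Lc) l))
          κ u κ' u')))) κ u κ' u' p z (Sum.inl β) b
        - (((1 : ℝ) / 2) • (unitS₂ (sfStep Lc l) (smStep 3 Lc l) (T2RecAt 3 Lc (toSite r) cE cVH cΛ cE₂ cB Tc vh₂S (mixFFAt (toSite r) Lc) l)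
        + (1 : ℝ) • fun κ u κ' u' => sgnK (trK ((unitS₂ (sfStep Lc l) (smStep 3 Lc l) (T2RecAt 3 Lc (toSite r) cE cVH cΛ cE₂ cB Tc vh₂S (mixFFAt (toSite r) Lc) l))
          κ u κ' u')))) κ u κ' u' (p - unitVec β) z (Sum.inl β) b)) CL₁ δ)
    (hL₂ : ∀ l, LocStencil₂ (fun κ u κ' u' => fun (x p : Fin (3 + 1) → ℤ) (a : Fib 3) (_ : Fib 3) =>
      ∑ β : Fin (3 + 1), ((((1 : ℝ) / 2) • (unitS₂ (sfStep Lc l) (smStep 3 Lc l) (T2RecAt 3 Lc (toSite r) cE cVH cΛ cE₂ cB Tc vh₂S (mixFFAt (toSite r) Lc) l)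
        + (1 : ℝ) • fun κ u κ' u' => sgnK (trK ((unitS₂ (sfStep Lc l) (smStep 3 Lc l) (T2RecAt 3 Lc (toSite r) cE cVH cΛ cE₂ cB Tc vh₂S (mixFFAt (toSite r) Lc) l))
          κ u κ' u')))) κ u κ' u' x p a (Sum.inl β)
        - (((1 : ℝ) / 2) • (unitS₂ (sfStep Lc l) (smStep 3 Lc l) (T2RecAt 3 Lc (toSite r) cE cVH cΛ cE₂ cB Tc vh₂S (mixFFAt (toSite r) Lc) l)
        + (1 : ℝ) • fun κ u κ' u' => sgnK (trK ((unitS₂ (sfStep Lc l) (smStep 3 Lc l) (T2RecAt 3 Lc (toSite r) cE cVH cΛ cE₂ cB Tc vh₂S (mixFFAt (toSite r) Lc) l))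
          κ u κ' u')))) κ u κ' u' x (p - unitVec β) a (Sum.inl β))) CL₂ δ)
    (hC : ∀ l, ∀ κ κ' κ₁ κ₂, zmode Lc (((1 : ℝ) / 2) • ((fun κ u κ' u' => (cE₂ * (Lc : ℝ) ^ (2 * (3 + 1))) • mmRead Lc (K3OfK (unitK (sfStep Lc l) (smStep 3 Lc
          l) (coDressKBmAt (toSite r) Lc (KInvStep (d := 3) Lc l))) Lc (unitS (sfStep Lc l) (smStep 3 Lc l) (SpureRecAt 3 Lc (toSite r) cE cVH cΛ l)) (unitM
          (sfStep Lc l) (smStep 3 Lc l) (M1At 3 Lc (toSite r) cΛ l)) (W2SymOfK (unitK (sfStep Lc l) (smStep 3 Lc l) (coDressKBmAt (toSite r) Lc (KInvStep (d :=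
          3) Lc l))) Lc (unitS (sfStep Lc l) (smStep 3 Lc l) (SpureRecAt 3 Lc (toSite r) cE cVH cΛ l)) (unitM (sfStep Lc l) (smStep 3 Lc l) (M1At 3 Lc (toSite
          r) cΛ l)) 0 (unitM₂ (sfStep Lc l) (smStep 3 Lc l) (M2Of 3 Lc (mixFFAt (toSite r) Lc) l))) κ u κ' u') + cB • vh₂S κ u κ' u') + (1 : ℝ) • fun κ u κ' u' =>
          sgnK (trK ((cE₂ * (Lc : ℝ) ^ (2 * (3 + 1))) • mmRead Lc (K3OfK (unitK (sfStep Lc l) (smStep 3 Lc l) (coDressKBmAt (toSite r) Lc (KInvStep (d := 3) Lc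
          l))) Lc (unitS (sfStep Lc l) (smStep 3 Lc l) (SpureRecAt 3 Lc (toSite r) cE cVH cΛ l)) (unitM (sfStep Lc l) (smStep 3 Lc l) (M1At 3 Lc (toSite r) cΛ
          l)) (W2SymOfK (unitK (sfStep Lc l) (smStep 3 Lc l) (coDressKBmAt (toSite r) Lc (KInvStep (d := 3) Lc l))) Lc (unitS (sfStep Lc l) (smStep 3 Lc l)
          (SpureRecAt 3 Lc (toSite r) cE cVH cΛ l)) (unitM (sfStep Lc l) (smStep 3 Lc l) (M1At 3 Lc (toSite r) cΛ l)) 0 (unitM₂ (sfStep Lc l) (smStep 3 Lc l)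
          (M2Of 3 Lc (mixFFAt (toSite r) Lc) l))) κ u κ' u') + cB • vh₂S κ u κ' u'))) +
          (lin4 (cE₂ * (Lc : ℝ) ^ (2 * (3 + 1))) (unitK (sfStep Lc l) (smStep 3 Lc l) (coDressKBmAt (toSite r) Lc (KInvStep (d := 3) Lc l))) Lc (((1 : ℝ) / 2)
                • (unitS₂ (sfStep Lc l) (smStep 3 Lc l) (T2RecAt 3 Lc (toSite r) cE cVH cΛ cE₂ cB Tc vh₂S (mixFFAt (toSite r) Lc) l) + (1 : ℝ) • fun κ u κ' u' =>
                sgnK (trK ((unitS₂ (sfStep Lc l) (smStep 3 Lc l) (T2RecAt 3 Lc (toSite r) cE cVH cΛ cE₂ cB Tc vh₂S (mixFFAt (toSite r) Lc) l)) κ u κ' u')))) -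
            lin4 (cE₂ * (Lc : ℝ) ^ (2 * (3 + 1))) (unitK (sfStep Lc l) (smStep 3 Lc l) (KInvStep (d := 3) Lc l)) Lc (((1 : ℝ) / 2) • (unitS₂ (sfStep Lc l)
                  (smStep 3 Lc l) (T2RecAt 3 Lc (toSite r) cE cVH cΛ cE₂ cB Tc vh₂S (mixFFAt (toSite r) Lc) l) + (1 : ℝ) • fun κ u κ' u' => sgnK (trK ((unitS₂
                  (sfStep Lc l) (smStep 3 Lc l) (T2RecAt 3 Lc (toSite r) cE cVH cΛ cE₂ cB Tc vh₂S (mixFFAt (toSite r) Lc) l)) κ u κ' u')))))) κ κ' (Sum.inl κ₁)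
                  (Sum.inl κ₂) + zmode Lc (((1 : ℝ) / 2) • ((fun κ u κ' u' => (cE₂ * (Lc : ℝ) ^ (2 * (3 + 1))) • mmRead Lc (K3OfK (unitK (sfStep Lc l) (smStep
                  3 Lc l) (coDressKBmAt (toSite r) Lc (KInvStep (d := 3) Lc l))) Lc (unitS (sfStep Lc l) (smStep 3 Lc l) (SpureRecAt 3 Lc (toSite r) cE cVH cΛ
                  l)) (unitM (sfStep Lc l) (smStep 3 Lc l) (M1At 3 Lc (toSite r) cΛ l)) (W2SymOfK (unitK (sfStep Lc l) (smStep 3 Lc l) (coDressKBmAt (toSite r)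
                  Lc (KInvStep (d := 3) Lc l))) Lc (unitS (sfStep Lc l) (smStep 3 Lc l) (SpureRecAt 3 Lc (toSite r) cE cVH cΛ l)) (unitM (sfStep Lc l) (smStep
                  3 Lc l) (M1At 3 Lc (toSite r) cΛ l)) 0 (unitM₂ (sfStep Lc l) (smStep 3 Lc l) (M2Of 3 Lc (mixFFAt (toSite r) Lc) l))) κ u κ' u') + cB • vh₂S κ
                  u κ' u') + (1 : ℝ) • fun κ u κ' u' => sgnK (trK ((cE₂ * (Lc : ℝ) ^ (2 * (3 + 1))) • mmRead Lc (K3OfK (unitK (sfStep Lc l) (smStep 3 Lc l)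
                  (coDressKBmAt (toSite r) Lc (KInvStep (d := 3) Lc l))) Lc (unitS (sfStep Lc l) (smStep 3 Lc l) (SpureRecAt 3 Lc (toSite r) cE cVH cΛ l))
                  (unitM (sfStep Lc l) (smStep 3 Lc l) (M1At 3 Lc (toSite r) cΛ l)) (W2SymOfK (unitK (sfStep Lc l) (smStep 3 Lc l) (coDressKBmAt (toSite r) Lc
                  (KInvStep (d := 3) Lc l))) Lc (unitS (sfStep Lc l) (smStep 3 Lc l) (SpureRecAt 3 Lc (toSite r) cE cVH cΛ l)) (unitM (sfStep Lc l) (smStep 3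
                  Lc l) (M1At 3 Lc (toSite r) cΛ l)) 0 (unitM₂ (sfStep Lc l) (smStep 3 Lc l) (M2Of 3 Lc (mixFFAt (toSite r) Lc) l))) κ u κ' u') + cB • vh₂S κ u κ' u'))) +
          (lin4 (cE₂ * (Lc : ℝ) ^ (2 * (3 + 1))) (unitK (sfStep Lc l) (smStep 3 Lc l) (coDressKBmAt (toSite r) Lc (KInvStep (d := 3) Lc l))) Lc (((1 : ℝ) / 2)
                • (unitS₂ (sfStep Lc l) (smStep 3 Lc l) (T2RecAt 3 Lc (toSite r) cE cVH cΛ cE₂ cB Tc vh₂S (mixFFAt (toSite r) Lc) l) + (1 : ℝ) • fun κ u κ' u' =>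
                sgnK (trK ((unitS₂ (sfStep Lc l) (smStep 3 Lc l) (T2RecAt 3 Lc (toSite r) cE cVH cΛ cE₂ cB Tc vh₂S (mixFFAt (toSite r) Lc) l)) κ u κ' u')))) -
            lin4 (cE₂ * (Lc : ℝ) ^ (2 * (3 + 1))) (unitK (sfStep Lc l) (smStep 3 Lc l) (KInvStep (d := 3) Lc l)) Lc (((1 : ℝ) / 2) • (unitS₂ (sfStep Lc l)
                  (smStep 3 Lc l) (T2RecAt 3 Lc (toSite r) cE cVH cΛ cE₂ cB Tc vh₂S (mixFFAt (toSite r) Lc) l) + (1 : ℝ) • fun κ u κ' u' => sgnK (trK ((unitS₂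
                  (sfStep Lc l) (smStep 3 Lc l) (T2RecAt 3 Lc (toSite r) cE cVH cΛ cE₂ cB Tc vh₂S (mixFFAt (toSite r) Lc) l)) κ u κ' u')))))) κ' κ (Sum.inl κ₁)
                  (Sum.inl κ₂) = 0) :
    ∃ C₂ δ₂ : ℝ, 0 < δ₂ ∧ ∀ n, LocStencil₂ (((1 : ℝ) / 2) • (unitS₂ (sfStep Lc n) (smStep 3 Lc n) (T2RecAt 3 Lc (toSite r) cE cVH cΛ cE₂ cB Tc vh₂S (mixFFAt
          (toSite r) Lc) n) + (1 : ℝ) • fun κ u κ' u' => sgnK (trK ((unitS₂ (sfStep Lc n) (smStep 3 Lc n) (T2RecAt 3 Lc (toSite r) cE cVH cΛ cE₂ cB Tc vh₂S (mixFFAt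
          (toSite r) Lc) n)) κ u κ' u')))) C₂ δ₂ := by
  have hLc1 : 1 ≤ Lc := le_trans (by norm_num) hLc
  -- the S-slot rows at the pin (the OWNER g22), hypothesis-free
  obtain ⟨Cs, cS, θS, δS, hθS0, hθS1, hδS, hall⟩ := exists_hS_hSall_SrecAt_three hLc hcE cVH cΛ
  obtain ⟨hS, hSall⟩ := hall r hr
  -- the two S-slot rows of the slaved summand at `ε = 1`, all levels, one constant (p2 g45 over MY FILE 4)
  obtain ⟨CE, δE, hδE, hE⟩ := exists_evenRows_uniform_three (Lc := Lc) hLc hcE hr cVH cΛ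
    (cE₂ * (Lc : ℝ) ^ (2 * (3 + 1)) * ((Lc : ℝ) ^ (3 + 1))⁻¹ / 2) cH hcH R R''
  -- the commutator word of the odd-rowed first-order table with the diagonal generators is parity-even (d1-leaf-05 ⨾ leaf-01)
  have hCm : ∀ (l : ℕ) (Y : Fin (3 + 1) → ℤ) (κ : Fin (3 + 1)) (u : Fin (3 + 1) → ℤ),
      trK (comp (SpureRecAt 3 Lc (toSite r) cE cVH cΛ l κ u) (diagK (((1 : ℝ) / 2) • ∑ v ∈ box (3 + 1) Lc, legInd (toSite r) ((Lc : ℤ) • Y + toSite v)))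
          - comp (diagK (((1 : ℝ) / 2) • ∑ v ∈ box (3 + 1) Lc, legInd (toSite r) ((Lc : ℤ) • Y + toSite v))) (SpureRecAt 3 Lc (toSite r) cE cVH cΛ l κ u))
        = sgnK (comp (SpureRecAt 3 Lc (toSite r) cE cVH cΛ l κ u) (diagK (((1 : ℝ) / 2) • ∑ v ∈ box (3 + 1) Lc, legInd (toSite r) ((Lc : ℤ) • Y + toSite v)))
          - comp (diagK (((1 : ℝ) / 2) • ∑ v ∈ box (3 + 1) Lc, legInd (toSite r) ((Lc : ℤ) • Y + toSite v))) (SpureRecAt 3 Lc (toSite r) cE cVH cΛ l κ u)) :=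
    fun l Y κ u => parityEven_comm_of_oddRows (fun κ u => trK_SpureRecAt hLc1 hr cE cVH cΛ l κ u)
      (fun Y => ((1 : ℝ) / 2) • ∑ v ∈ box (3 + 1) Lc, legInd (toSite r) ((Lc : ℤ) • Y + toSite v)) Y κ u
  exact locStencil₂_halfMember_three_of_letterRows (S := fun l => SpureRecAt 3 Lc (toSite r) cE cVH cΛ l)
    (X := fun Y => diagK (((1 : ℝ) / 2) • ∑ v ∈ box (3 + 1) Lc, legInd (toSite r) ((Lc : ℤ) • Y + toSite v)))
    hLc hr cE cVH cΛ cE₂ cB hpin Tc hBff hBmm hB hδB hBt hS hSall hδS hθS0 hθS1 1 (by norm_num) hcH0 hTL hTL'' hCm hR hR'' hδE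
    (fun l => (hE l).1) (fun l => (hE l).2) hδ hL₁ hL₂ hC

/-- NOT IN PRINT; OUR BOOKKEEPING.  **THE SAME, JUNCTION SPELLING** `½ • (T♮̃_n + P T♮̃_n)` (p2 g44's `one_smul` bridge; the spelling of the OWNER's `t2ShapeEven_three_of_rows` and of
p2 g45's capstone `hT₂`). -/
theorem t2ShapeEven_three_of_wardLetters_junction (hLc : 2 ≤ Lc) (hr : r ∈ box (3 + 1) Lc) (cE cVH cΛ cE₂ cB : ℝ) (hcE : cE = (Lc : ℝ) ^ (3 + 1))
    (hpin : |cE₂| ≤ (Lc : ℝ) ^ (2 * (3 + 1))) (Tc : Fin 4 → Fin 4 → Fin 4 → Fin 4 → ℝ)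
    {vh₂S : Fin (3 + 1) → (Fin (3 + 1) → ℤ) → Fin (3 + 1) → (Fin (3 + 1) → ℤ) → MKer (3 + 1) (Fib 3)}
    (hBff : ∀ κ u κ' u' x z (α β : Fin (3 + 1)), vh₂S κ u κ' u' x z (Sum.inl α) (Sum.inl β) = 0)
    (hBmm : ∀ κ u κ' u' x z (μ ν : Fin (3 + 1)), vh₂S κ u κ' u' x z (Sum.inr μ) (Sum.inr ν) = 0)
    {CB δB : ℝ} (hB : LocStencil₂ vh₂S CB δB) (hδB : 0 < δB)
    (hBt : ∀ (κ : Fin (3 + 1)) (u : Fin (3 + 1) → ℤ) (κ' : Fin (3 + 1)) (u' t : Fin (3 + 1) → ℤ),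
        vh₂S κ (u + (Lc : ℤ) • t) κ' (u' + (Lc : ℤ) • t) = shiftK (-((Lc : ℤ) • t)) (vh₂S κ u κ' u'))
     {R R'' : ℕ → (Fin (3 + 1) → ℤ) → Fin (3 + 1) → (Fin (3 + 1) → ℤ) → MKer (3 + 1) (Fib 3)} {cH : ℕ → ℝ} (hcH0 : ∀ l, cH l ≠ 0) {c₀ : ℝ}
    (hcH : ∀ l, |(sfStep Lc l * smStep 3 Lc l)⁻¹ * (cH l)⁻¹| ≤ c₀)
    (hTL : ∀ (l : ℕ) (Y : Fin (3 + 1) → ℤ) (κ' : Fin (3 + 1)) (u' : Fin (3 + 1) → ℤ),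
      cH l • ∑ v ∈ box (3 + 1) Lc, divV (fun κ u => T2RecAt 3 Lc (toSite r) cE cVH cΛ cE₂ cB Tc vh₂S (mixFFAt (toSite r) Lc) l κ u κ' u') ((Lc : ℤ) • Y + toSite v)
        = comp (SpureRecAt 3 Lc (toSite r) cE cVH cΛ l κ' u') (diagK (((1 : ℝ) / 2) • ∑ v ∈ box (3 + 1) Lc, legInd (toSite r) ((Lc : ℤ) • Y + toSite v))) - comp (diagK (((1 : ℝ) / 2) • ∑ v ∈ box (3 + 1) Lc, legInd (toSite r) ((Lc : ℤ) • Y + toSite v))) (SpureRecAt 3 Lc (toSite r) cE cVH cΛ l κ' u') + R l Y κ' u')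
    (hTL'' : ∀ (l : ℕ) (Y : Fin (3 + 1) → ℤ) (κ : Fin (3 + 1)) (u : Fin (3 + 1) → ℤ),
      cH l • ∑ v ∈ box (3 + 1) Lc, divV (T2RecAt 3 Lc (toSite r) cE cVH cΛ cE₂ cB Tc vh₂S (mixFFAt (toSite r) Lc) l κ u) ((Lc : ℤ) • Y + toSite v)
        = comp (SpureRecAt 3 Lc (toSite r) cE cVH cΛ l κ u) (diagK (((1 : ℝ) / 2) • ∑ v ∈ box (3 + 1) Lc, legInd (toSite r) ((Lc : ℤ) • Y + toSite v))) - comp (diagK (((1 : ℝ) / 2) • ∑ v ∈ box (3 + 1) Lc, legInd (toSite r) ((Lc : ℤ) • Y + toSite v))) (SpureRecAt 3 Lc (toSite r) cE cVH cΛ l κ u) + R'' l Y κ u)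
    (hR : ∀ (l : ℕ) (Y : Fin (3 + 1) → ℤ) (κ : Fin (3 + 1)) (u : Fin (3 + 1) → ℤ), trK (R l Y κ u) = -sgnK (R l Y κ u))
    (hR'' : ∀ (l : ℕ) (Y : Fin (3 + 1) → ℤ) (κ : Fin (3 + 1)) (u : Fin (3 + 1) → ℤ), trK (R'' l Y κ u) = -sgnK (R'' l Y κ u))
    {CL₁ CL₂ δ : ℝ} (hδ : 0 < δ)
    (hL₁ : ∀ l, LocStencil₂ (fun κ u κ' u' => fun (p z : Fin (3 + 1) → ℤ) (_ : Fib 3) (b : Fib 3) =>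
      ∑ β : Fin (3 + 1), ((((1 : ℝ) / 2) • (unitS₂ (sfStep Lc l) (smStep 3 Lc l) (T2RecAt 3 Lc (toSite r) cE cVH cΛ cE₂ cB Tc vh₂S (mixFFAt (toSite r) Lc) l)
        + (1 : ℝ) • fun κ u κ' u' => sgnK (trK ((unitS₂ (sfStep Lc l) (smStep 3 Lc l) (T2RecAt 3 Lc (toSite r) cE cVH cΛ cE₂ cB Tc vh₂S (mixFFAt (toSite r) Lc) l))
          κ u κ' u')))) κ u κ' u' p z (Sum.inl β) b
        - (((1 : ℝ) / 2) • (unitS₂ (sfStep Lc l) (smStep 3 Lc l) (T2RecAt 3 Lc (toSite r) cE cVH cΛ cE₂ cB Tc vh₂S (mixFFAt (toSite r) Lc) l)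
        + (1 : ℝ) • fun κ u κ' u' => sgnK (trK ((unitS₂ (sfStep Lc l) (smStep 3 Lc l) (T2RecAt 3 Lc (toSite r) cE cVH cΛ cE₂ cB Tc vh₂S (mixFFAt (toSite r) Lc) l))
          κ u κ' u')))) κ u κ' u' (p - unitVec β) z (Sum.inl β) b)) CL₁ δ)
    (hL₂ : ∀ l, LocStencil₂ (fun κ u κ' u' => fun (x p : Fin (3 + 1) → ℤ) (a : Fib 3) (_ : Fib 3) =>
      ∑ β : Fin (3 + 1), ((((1 : ℝ) / 2) • (unitS₂ (sfStep Lc l) (smStep 3 Lc l) (T2RecAt 3 Lc (toSite r) cE cVH cΛ cE₂ cB Tc vh₂S (mixFFAt (toSite r) Lc) l)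
        + (1 : ℝ) • fun κ u κ' u' => sgnK (trK ((unitS₂ (sfStep Lc l) (smStep 3 Lc l) (T2RecAt 3 Lc (toSite r) cE cVH cΛ cE₂ cB Tc vh₂S (mixFFAt (toSite r) Lc) l))
          κ u κ' u')))) κ u κ' u' x p a (Sum.inl β)
        - (((1 : ℝ) / 2) • (unitS₂ (sfStep Lc l) (smStep 3 Lc l) (T2RecAt 3 Lc (toSite r) cE cVH cΛ cE₂ cB Tc vh₂S (mixFFAt (toSite r) Lc) l)
        + (1 : ℝ) • fun κ u κ' u' => sgnK (trK ((unitS₂ (sfStep Lc l) (smStep 3 Lc l) (T2RecAt 3 Lc (toSite r) cE cVH cΛ cE₂ cB Tc vh₂S (mixFFAt (toSite r) Lc) l))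
          κ u κ' u')))) κ u κ' u' x (p - unitVec β) a (Sum.inl β))) CL₂ δ)
    (hC : ∀ l, ∀ κ κ' κ₁ κ₂, zmode Lc (((1 : ℝ) / 2) • ((fun κ u κ' u' => (cE₂ * (Lc : ℝ) ^ (2 * (3 + 1))) • mmRead Lc (K3OfK (unitK (sfStep Lc l) (smStep 3 Lc
          l) (coDressKBmAt (toSite r) Lc (KInvStep (d := 3) Lc l))) Lc (unitS (sfStep Lc l) (smStep 3 Lc l) (SpureRecAt 3 Lc (toSite r) cE cVH cΛ l)) (unitM
          (sfStep Lc l) (smStep 3 Lc l) (M1At 3 Lc (toSite r) cΛ l)) (W2SymOfK (unitK (sfStep Lc l) (smStep 3 Lc l) (coDressKBmAt (toSite r) Lc (KInvStep (d :=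
          3) Lc l))) Lc (unitS (sfStep Lc l) (smStep 3 Lc l) (SpureRecAt 3 Lc (toSite r) cE cVH cΛ l)) (unitM (sfStep Lc l) (smStep 3 Lc l) (M1At 3 Lc (toSite
          r) cΛ l)) 0 (unitM₂ (sfStep Lc l) (smStep 3 Lc l) (M2Of 3 Lc (mixFFAt (toSite r) Lc) l))) κ u κ' u') + cB • vh₂S κ u κ' u') + (1 : ℝ) • fun κ u κ' u' =>
          sgnK (trK ((cE₂ * (Lc : ℝ) ^ (2 * (3 + 1))) • mmRead Lc (K3OfK (unitK (sfStep Lc l) (smStep 3 Lc l) (coDressKBmAt (toSite r) Lc (KInvStep (d := 3) Lc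
          l))) Lc (unitS (sfStep Lc l) (smStep 3 Lc l) (SpureRecAt 3 Lc (toSite r) cE cVH cΛ l)) (unitM (sfStep Lc l) (smStep 3 Lc l) (M1At 3 Lc (toSite r) cΛ
          l)) (W2SymOfK (unitK (sfStep Lc l) (smStep 3 Lc l) (coDressKBmAt (toSite r) Lc (KInvStep (d := 3) Lc l))) Lc (unitS (sfStep Lc l) (smStep 3 Lc l)
          (SpureRecAt 3 Lc (toSite r) cE cVH cΛ l)) (unitM (sfStep Lc l) (smStep 3 Lc l) (M1At 3 Lc (toSite r) cΛ l)) 0 (unitM₂ (sfStep Lc l) (smStep 3 Lc l)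
          (M2Of 3 Lc (mixFFAt (toSite r) Lc) l))) κ u κ' u') + cB • vh₂S κ u κ' u'))) +
          (lin4 (cE₂ * (Lc : ℝ) ^ (2 * (3 + 1))) (unitK (sfStep Lc l) (smStep 3 Lc l) (coDressKBmAt (toSite r) Lc (KInvStep (d := 3) Lc l))) Lc (((1 : ℝ) / 2)
                • (unitS₂ (sfStep Lc l) (smStep 3 Lc l) (T2RecAt 3 Lc (toSite r) cE cVH cΛ cE₂ cB Tc vh₂S (mixFFAt (toSite r) Lc) l) + (1 : ℝ) • fun κ u κ' u' =>
                sgnK (trK ((unitS₂ (sfStep Lc l) (smStep 3 Lc l) (T2RecAt 3 Lc (toSite r) cE cVH cΛ cE₂ cB Tc vh₂S (mixFFAt (toSite r) Lc) l)) κ u κ' u')))) -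
            lin4 (cE₂ * (Lc : ℝ) ^ (2 * (3 + 1))) (unitK (sfStep Lc l) (smStep 3 Lc l) (KInvStep (d := 3) Lc l)) Lc (((1 : ℝ) / 2) • (unitS₂ (sfStep Lc l)
                  (smStep 3 Lc l) (T2RecAt 3 Lc (toSite r) cE cVH cΛ cE₂ cB Tc vh₂S (mixFFAt (toSite r) Lc) l) + (1 : ℝ) • fun κ u κ' u' => sgnK (trK ((unitS₂
                  (sfStep Lc l) (smStep 3 Lc l) (T2RecAt 3 Lc (toSite r) cE cVH cΛ cE₂ cB Tc vh₂S (mixFFAt (toSite r) Lc) l)) κ u κ' u')))))) κ κ' (Sum.inl κ₁)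
                  (Sum.inl κ₂) + zmode Lc (((1 : ℝ) / 2) • ((fun κ u κ' u' => (cE₂ * (Lc : ℝ) ^ (2 * (3 + 1))) • mmRead Lc (K3OfK (unitK (sfStep Lc l) (smStep
                  3 Lc l) (coDressKBmAt (toSite r) Lc (KInvStep (d := 3) Lc l))) Lc (unitS (sfStep Lc l) (smStep 3 Lc l) (SpureRecAt 3 Lc (toSite r) cE cVH cΛ
                  l)) (unitM (sfStep Lc l) (smStep 3 Lc l) (M1At 3 Lc (toSite r) cΛ l)) (W2SymOfK (unitK (sfStep Lc l) (smStep 3 Lc l) (coDressKBmAt (toSite r)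
                  Lc (KInvStep (d := 3) Lc l))) Lc (unitS (sfStep Lc l) (smStep 3 Lc l) (SpureRecAt 3 Lc (toSite r) cE cVH cΛ l)) (unitM (sfStep Lc l) (smStep
                  3 Lc l) (M1At 3 Lc (toSite r) cΛ l)) 0 (unitM₂ (sfStep Lc l) (smStep 3 Lc l) (M2Of 3 Lc (mixFFAt (toSite r) Lc) l))) κ u κ' u') + cB • vh₂S κ
                  u κ' u') + (1 : ℝ) • fun κ u κ' u' => sgnK (trK ((cE₂ * (Lc : ℝ) ^ (2 * (3 + 1))) • mmRead Lc (K3OfK (unitK (sfStep Lc l) (smStep 3 Lc l)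
                  (coDressKBmAt (toSite r) Lc (KInvStep (d := 3) Lc l))) Lc (unitS (sfStep Lc l) (smStep 3 Lc l) (SpureRecAt 3 Lc (toSite r) cE cVH cΛ l))
                  (unitM (sfStep Lc l) (smStep 3 Lc l) (M1At 3 Lc (toSite r) cΛ l)) (W2SymOfK (unitK (sfStep Lc l) (smStep 3 Lc l) (coDressKBmAt (toSite r) Lc
                  (KInvStep (d := 3) Lc l))) Lc (unitS (sfStep Lc l) (smStep 3 Lc l) (SpureRecAt 3 Lc (toSite r) cE cVH cΛ l)) (unitM (sfStep Lc l) (smStep 3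
                  Lc l) (M1At 3 Lc (toSite r) cΛ l)) 0 (unitM₂ (sfStep Lc l) (smStep 3 Lc l) (M2Of 3 Lc (mixFFAt (toSite r) Lc) l))) κ u κ' u') + cB • vh₂S κ u κ' u'))) +
          (lin4 (cE₂ * (Lc : ℝ) ^ (2 * (3 + 1))) (unitK (sfStep Lc l) (smStep 3 Lc l) (coDressKBmAt (toSite r) Lc (KInvStep (d := 3) Lc l))) Lc (((1 : ℝ) / 2)
                • (unitS₂ (sfStep Lc l) (smStep 3 Lc l) (T2RecAt 3 Lc (toSite r) cE cVH cΛ cE₂ cB Tc vh₂S (mixFFAt (toSite r) Lc) l) + (1 : ℝ) • fun κ u κ' u' =>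
                sgnK (trK ((unitS₂ (sfStep Lc l) (smStep 3 Lc l) (T2RecAt 3 Lc (toSite r) cE cVH cΛ cE₂ cB Tc vh₂S (mixFFAt (toSite r) Lc) l)) κ u κ' u')))) -
            lin4 (cE₂ * (Lc : ℝ) ^ (2 * (3 + 1))) (unitK (sfStep Lc l) (smStep 3 Lc l) (KInvStep (d := 3) Lc l)) Lc (((1 : ℝ) / 2) • (unitS₂ (sfStep Lc l)
                  (smStep 3 Lc l) (T2RecAt 3 Lc (toSite r) cE cVH cΛ cE₂ cB Tc vh₂S (mixFFAt (toSite r) Lc) l) + (1 : ℝ) • fun κ u κ' u' => sgnK (trK ((unitS₂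
                  (sfStep Lc l) (smStep 3 Lc l) (T2RecAt 3 Lc (toSite r) cE cVH cΛ cE₂ cB Tc vh₂S (mixFFAt (toSite r) Lc) l)) κ u κ' u')))))) κ' κ (Sum.inl κ₁)
                  (Sum.inl κ₂) = 0) :
    ∃ C₂ δ₂ : ℝ, 0 < δ₂ ∧ ∀ n, LocStencil₂ (((1 : ℝ) / 2) • (unitS₂ (sfStep Lc n) (smStep 3 Lc n) (T2RecAt 3 Lc (toSite r) cE cVH cΛ cE₂ cB Tc vh₂S (mixFFAt
          (toSite r) Lc) n) + fun κ u κ' u' => sgnK (trK ((unitS₂ (sfStep Lc n) (smStep 3 Lc n) (T2RecAt 3 Lc (toSite r) cE cVH cΛ cE₂ cB Tc vh₂S (mixFFAt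
          (toSite r) Lc) n)) κ u κ' u')))) C₂ δ₂ := by
  have h := t2ShapeEven_three_of_wardLetters hLc hr cE cVH cΛ cE₂ cB hcE hpin Tc hBff hBmm hB hδB hBt hcH0 hcH hTL hTL'' hR hR'' hδ hL₁ hL₂ hC
  simpa only [one_smul] using h

end Summit.QuantumFields.BalabanUV.Beta.GAN24.T2ShapeEvenMemberOfWardLetters

end
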